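import Literature.Geometry.GeometricMeasureTheory.DeformationCycle
import HarnessLib

/-!
# The cubical retraction of a rectifiable `1`-current with finite boundary mass

Support file for the boundary-rectifiability theorem [Federer1969, 4.2.16 (2)], base case
`m = 0`: the companion of `SkeletonRetract.lean` (degrees `≥ 2`) in degree `1`, where the boundary
`∂S` is a `0`-current and Federer's `∂ (σ ∘ τ_a)_{#v} S = (σ ∘ τ_a)_{#v} ∂S` (4.2.2) is not
available in the tree's Lipschitz framework (no push-forward of `0`-currents along Lipschitz
maps). We prove instead, directly from the every-degree estimates of
`CurrentsAdmissibleCycle.lean` (`Current.mass_boundary_lipPushforward_le'`: `𝐌(∂F_#T) ≤ 𝐌(∂T)`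
in degree `1`; `Current.mass_lipHomotopyError_le`: the homotopy error has mass `≤ η 𝐌(∂T)` in
degree `1`; good sequences with slice decay `𝐌⟨S, v, r_j+⟩ → 0`, `Current.exists_goodSeq_decay'`)
and lower semicontinuity of mass:

* `Current.mass_boundary_restrictAbove_le` — `𝐌(∂(S ⌞ {v > r})) ≤ 𝐌(∂S) + 𝐌⟨S, v, r+⟩`;
* `Current.mass_boundary_admPushLim_le_one` — **`𝐌(∂ g_{#v} S) ≤ 𝐌(∂S)`** for `S` of degree `1`;
* `Current.mass_admHomError_le_one` — **`𝐌(g₂{#v} S − g₁{#v} S − ∂ H_v(g₁,g₂) S) ≤ √n η₀ 𝐌(∂S)`**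
  for `S` of degree `1` (Federer's homotopy formula 4.2.2 with the `0`-dimensional term estimated
  rather than identified);
* **`Current.IsRectifiable.exists_skeleton_retract_one`** — for `1 ≤ n = dim V` there is `γ'` such
  that for every `ε > 0` and every `S ∈ 𝓡_1(V)` with `𝐌(∂S) < ∞` there are `Q ∈ 𝓡_1(V)` carried by
  the `1`-skeleton `μ_ε W'_1`, a `1`-current `R` and a `2`-current `H` with `S − Q = R + ∂H`,
  `𝐌(∂Q) ≤ 𝐌(∂S)`, `𝐌(R) ≤ ε γ' 𝐌(∂S)`, all supported in `{dist(·, spt S) ≤ 3√n ε}`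
  [Federer1969, 4.2.9 for `T ∈ 𝓡_1 ∩ 𝐍_1`, without the integrality clause (6)].

Theorems only; no new definitions, no named facts.

## References

* H. Federer, *Geometric Measure Theory*, Springer 1969, 4.1.9, 4.1.14, 4.2.1, 4.2.2, 4.2.9,
  4.2.16 (held copy `lit book:federernd-geometric-measure-theory`, PDF pp. 334–345, 350)
  [Federer1969].
* B. White, *A new proof of the compactness theorem for integral currents*, Comment. Math. Helv.
  64 (1989), §1.5 p. 210 [White1989].
-/

noncomputable section

open scoped Distributions ENNReal NNReal Topology ContDiff InnerProductSpace RealInnerProductSpace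
open MeasureTheory TopologicalSpace Set Filter Metric Function Module

namespace Literature.Geometry.GeometricMeasureTheory

set_option maxSynthPendingDepth 2

/-! ### Degree-one estimates for the admissible push-forward and homotopy -/

section DegreeOne

variable {V : Type*} [NormedAddCommGroup V] [InnerProductSpace ℝ V] [FiniteDimensional ℝ V]
  [MeasurableSpace V] [BorelSpace V] {n d : ℕ} {v : V → ℝ} {g g₁ g₂ : V → V} {C : ℝ}

/-- **`𝐌(∂(S ⌞ {v > r})) ≤ 𝐌(∂S) + 𝐌⟨S, v, r+⟩`**: `∂(S ⌞ {v > r}) = (∂S) ⌞ {v > r} − ⟨S, v, r+⟩`.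
[cite: Federer1969, 4.2.1] -/
theorem Current.mass_boundary_restrictAbove_le {S : Current (⊤ : Opens V) (d + 1)} (hS : S.mass ≠ ⊤)
    (hdS : S.boundary.mass ≠ ⊤) (hv : LipschitzWith 1 v) (r : ℝ) :
    (S.restrictAbove hS hv.continuous r).boundary.mass ≤ S.boundary.mass +
      ((S.isRepresentable_of_mass_ne_top hS).slice (S.boundary.isRepresentable_of_mass_ne_top hdS)
        hv.continuous r).mass := by
  set hT := S.isRepresentable_of_mass_ne_top hS
  set hdT := S.boundary.isRepresentable_of_mass_ne_top hdS
  have e : (S.restrictAbove hS hv.continuous r).boundary =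
      hdT.restrictSet {x | r < v x} (measurableSet_lt_of_continuous hv.continuous r) -
        hT.slice hdT hv.continuous r := by
    simp only [Current.IsRepresentable.slice, Current.restrictAbove, sub_sub_cancel]
  rw [e, sub_eq_add_neg]
  refine (Current.mass_add_le _ _).trans (add_le_add ?_ (by rw [Current.mass_neg]))
  exact (hdT.mass_restrictSet_le _).trans (S.boundary.variation_le_mass _)

variable {S : Current (⊤ : Opens V) (0 + 1)}
  (b : OrthonormalBasis (Fin n) ℝ V) (hS : S.mass ≠ ⊤) (hdS : S.boundary.mass ≠ ⊤)
  (hsupp : IsCompact S.support) (hv : LipschitzWith 1 v) (hadm : Admissible v g C)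
  (h₁ : Admissible v g₁ C) (h₂ : Admissible v g₂ C)
  (hC : 0 ≤ C) {η₀ : ℝ} (hη₀ : 0 ≤ η₀) (hclose : ∀ x, 0 < v x → ‖g₂ x - g₁ x‖ ≤ η₀)
  {ε : ℝ} (hε : 0 < ε) (hvε : ∀ x, v x ≤ ε)
  (hI : ∫⁻ x, admWeight v 0 x ∂S.variation ≠ ⊤)

include hdS in
/-- **`𝐌(∂ g_{#v} S) ≤ 𝐌(∂S)` in degree one.** Along a good sequence with slice decay,
`∂ P_{r_j} = ∂ (G_{r_j})_# (S ⌞ {v > r_j})` has mass `≤ 𝐌(∂(S ⌞ {v > r_j})) ≤ 𝐌(∂S) + 𝐌⟨S, v, r_j+⟩`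
(no Lipschitz constant enters in degree `0`), and `𝐌⟨S, v, r_j+⟩ → 0`; lower semicontinuity of
mass under the weak convergence `∂P_{r_j} → ∂ g_{#v} S`. [cite: Federer1969, 4.1.14, 4.2.2] -/
theorem Current.mass_boundary_admPushLim_le_one {P : ℝ → Prop} (R : S.GoodSeq hS hv.continuous ε P) :
    (S.admPushLim b hS hsupp hv.continuous hadm hC hε R hvε hI).boundary.mass ≤ S.boundary.mass := by
  obtain ⟨P', R', -, hdecay⟩ := S.exists_goodSeq_decay' (n := n) hS hdS hv hε hI hC (Q := fun _ => True)
    (Eventually.of_forall fun _ => trivial)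
  simp only [pow_zero, one_mul] at hdecay
  rw [S.admPushLim_eq b hS hsupp hv.continuous hadm hC hε R hvε hI R']
  set hT := S.isRepresentable_of_mass_ne_top hS
  set hdT := S.boundary.isRepresentable_of_mass_ne_top hdS
  have htend : ∀ ψ : TestForm (⊤ : Opens V) 0, Tendsto (fun j =>
      (S.admPush b hS hsupp hv.continuous hadm hC (R'.pos hε j) (R'.good j)).boundary ψ) atTop
      (𝓝 ((S.admPushLim b hS hsupp hv.continuous hadm hC hε R' hvε hI).boundary ψ)) := fun ψ => by
    simp only [Current.boundary_apply]
    exact S.tendsto_admPush b hS hsupp hv.continuous hadm hC hε R' hvε hI (TestForm.extDerivCLM ψ)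
  refine (Current.mass_le_liminf htend).trans ?_
  have hbm : ∀ j, (S.admPush b hS hsupp hv.continuous hadm hC (R'.pos hε j) (R'.good j)).boundary.mass ≤
      S.boundary.mass + (hT.slice hdT hv.continuous (R'.r j)).mass := fun j => by
    unfold Current.admPush
    refine (Current.mass_boundary_lipPushforward_le' _ _ _ _ _).trans ?_
    rw [pow_zero, one_mul]
    exact S.mass_boundary_restrictAbove_le hS hdS hv _
  have hlim : Tendsto (fun j => S.boundary.mass + (hT.slice hdT hv.continuous (R'.r j)).mass) atTop
      (𝓝 (S.boundary.mass + 0)) := tendsto_const_nhds.add hdecay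
  rw [add_zero] at hlim
  rw [← hlim.liminf_eq]
  exact liminf_le_liminf (Eventually.of_forall hbm)

include hdS hη₀ hclose in
/-- **The homotopy error in degree one: `𝐌(g₂{#v} S − g₁{#v} S − ∂ H_v(g₁,g₂) S) ≤ √n η₀ 𝐌(∂S)`.**
At a good radius the error `(G²_r)_# X_r − (G¹_r)_# X_r − ∂ H(G¹_r, G²_r) X_r`, `X_r = S ⌞ {v > r}`,
has mass `≤ √n η₀ 𝐌(∂X_r) ≤ √n η₀ (𝐌(∂S) + 𝐌⟨S, v, r+⟩)` (`Current.mass_lipHomotopyError_le` in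
degree `1`), and along a good sequence with slice decay these converge weakly to the error of the
limits; lower semicontinuity of mass. [cite: Federer1969, 4.1.9, 4.2.2] -/
theorem Current.mass_admHomError_le_one {P₁ P₂ P₃ : ℝ → Prop}
    (R₁ : S.GoodSeq hS hv.continuous ε P₁) (R₂ : S.GoodSeq hS hv.continuous ε P₂)
    (R₃ : S.GoodSeq hS hv.continuous ε P₃) :
    (S.admPushLim b hS hsupp hv.continuous h₂ hC hε R₂ hvε hI -
        S.admPushLim b hS hsupp hv.continuous h₁ hC hε R₁ hvε hI -
        (S.admHomLim b hS hsupp hv.continuous h₁ h₂ hC hη₀ hclose hε R₃ hvε hI).boundary).mass ≤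
      ENNReal.ofReal (Real.sqrt n * η₀) * S.boundary.mass := by
  obtain ⟨P', R', -, hdecay⟩ := S.exists_goodSeq_decay' (n := n) hS hdS hv hε hI hC (Q := fun _ => True)
    (Eventually.of_forall fun _ => trivial)
  simp only [pow_zero, one_mul] at hdecay
  rw [S.admPushLim_eq b hS hsupp hv.continuous h₂ hC hε R₂ hvε hI R',
    S.admPushLim_eq b hS hsupp hv.continuous h₁ hC hε R₁ hvε hI R',
    S.admHomLim_eq b hS hsupp hv.continuous h₁ h₂ hC hη₀ hclose hε R₃ hvε hI R']
  set hT := S.isRepresentable_of_mass_ne_top hS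
  set hdT := S.boundary.isRepresentable_of_mass_ne_top hdS
  -- the error currents at the radii `r_j` and their masses
  have hkey : ∀ j, ∃ Ej : Current (⊤ : Opens V) (0 + 1),
      S.admPush b hS hsupp hv.continuous h₂ hC (R'.pos hε j) (R'.good j) -
        S.admPush b hS hsupp hv.continuous h₁ hC (R'.pos hε j) (R'.good j) -
        (S.admHom b hS hsupp hv.continuous h₁ h₂ hC hη₀ hclose (R'.pos hε j) (R'.good j)).boundary = Ej ∧
      Ej.mass ≤ ENNReal.ofReal (Real.sqrt n * η₀) *
        (S.boundary.mass + (hT.slice hdT hv.continuous (R'.r j)).mass) := by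
    intro j
    set r := R'.r j
    have hr : 0 < r := R'.pos hε j
    have hgood := R'.good j
    set X := S.restrictAbove hS hv.continuous r with hX
    have hXm : X.mass ≠ ⊤ := S.mass_restrictAbove_ne_top hS hv.continuous r
    have hXc : IsCompact X.support := S.isCompact_support_restrictAbove hS hsupp hv.continuous r
    have hP2 : S.admPush b hS hsupp hv.continuous h₂ hC hr hgood =
        X.lipPushforward hXm hgood hXc (h₁.lipschitzWith_ext₂ b h₂ hC hη₀ hclose hr) ⊤ := by
      unfold Current.admPush
      refine X.lipPushforward_congr hXm hgood hXc (h₂.lipschitzWith_ext b hC hr)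
        (h₁.lipschitzWith_ext₂ b h₂ hC hη₀ hclose hr) (N := {x | r / 2 < v x})
        (isOpen_lt continuous_const hv.continuous)
        ((S.support_restrictAbove_subset hS hv.continuous r).trans fun x hx => ?_) fun x hx => ?_
      · show r / 2 < v x
        have : r ≤ v x := hx
        linarith
      · have hx' : r / 2 < v x := hx
        rw [h₂.ext_eqOn b hC hr hx'.le, h₁.ext₂_eqOn b h₂ hC hη₀ hclose hr hx'.le]
    refine ⟨_, rfl, ?_⟩
    rw [hP2]
    unfold Current.admPush Current.admHom
    refine (X.mass_lipHomotopyError_le hXm hgood hXc (h₁.lipschitzWith_ext b hC hr)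
      (h₁.lipschitzWith_ext₂ b h₂ hC hη₀ hclose hr) (sqrt_mul_nonneg n hη₀)
      (h₁.norm_ext₂_sub_ext_le b h₂ hC hη₀ hclose hr)).trans ?_
    rw [pow_zero, mul_one]
    exact mul_le_mul' le_rfl (S.mass_boundary_restrictAbove_le hS hdS hv r)
  choose Ej hEj hEjm using hkey
  -- weak convergence of the errors to the error of the limits
  have htend : ∀ ψ : TestForm (⊤ : Opens V) (0 + 1), Tendsto (fun j => Ej j ψ) atTop
      (𝓝 ((S.admPushLim b hS hsupp hv.continuous h₂ hC hε R' hvε hI -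
        S.admPushLim b hS hsupp hv.continuous h₁ hC hε R' hvε hI -
        (S.admHomLim b hS hsupp hv.continuous h₁ h₂ hC hη₀ hclose hε R' hvε hI).boundary) ψ)) := by
    intro ψ
    have t1 := ((S.tendsto_admPush b hS hsupp hv.continuous h₂ hC hε R' hvε hI ψ).sub
      (S.tendsto_admPush b hS hsupp hv.continuous h₁ hC hε R' hvε hI ψ)).sub
      (S.tendsto_admHom b hS hsupp hv.continuous h₁ h₂ hC hη₀ hclose hε R' hvε hI (TestForm.extDerivCLM ψ))
    refine (t1.congr fun j => ?_)
    have := DFunLike.congr_fun (hEj j) ψ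
    rw [← this]
    rfl
  refine (Current.mass_le_liminf htend).trans ?_
  have hlim : Tendsto (fun j => ENNReal.ofReal (Real.sqrt n * η₀) *
      (S.boundary.mass + (hT.slice hdT hv.continuous (R'.r j)).mass)) atTop
      (𝓝 (ENNReal.ofReal (Real.sqrt n * η₀) * (S.boundary.mass + 0))) :=
    ENNReal.Tendsto.const_mul (tendsto_const_nhds.add hdecay) (Or.inr ENNReal.ofReal_ne_top)
  rw [add_zero] at hlim
  rw [← hlim.liminf_eq]
  exact liminf_le_liminf (Eventually.of_forall hEjm)

end DegreeOne

/-! ### The retraction of a rectifiable `1`-current onto the `1`-skeleton -/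

section Retract

open Cubical

variable {V : Type*} [NormedAddCommGroup V] [InnerProductSpace ℝ V] [FiniteDimensional ℝ V]
  [MeasurableSpace V] [BorelSpace V] {n : ℕ}

/-- **The cubical retraction of a rectifiable `1`-current with finite boundary mass**
[Federer1969, 4.2.9 for `T ∈ 𝓡_1 ∩ 𝐍_1`, without the integrality clause (6)]: for
`1 ≤ n = dim V` there is `γ' ≥ 0` such that for every `ε > 0` and every `S ∈ 𝓡_1(V)` with
`𝐌(∂S) < ∞` there are a rectifiable `1`-current `Q` (`= (σ_1 ∘ τ_a)_{#v} S`) carried by the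
`1`-skeleton `μ_ε W'_1`, a `1`-current `R` and a `2`-current `H` with `S − Q = R + ∂H`,
`𝐌(∂Q) ≤ 𝐌(∂S)`, `𝐌(R) ≤ ε γ' 𝐌(∂S)`, and `spt Q, spt R, spt H ⊆ {dist(·, spt S) ≤ 3√n ε}`
(`H = Σᵢ H_v(σᵢ τ_a, σᵢ₊₁ τ_a) S +` the affine homotopy to the identity; `R` collects the
degree-zero homotopy errors, of mass `≤ 2√n ε · 𝐌(∂S)` each). [cite: Federer1969, 4.2.2, 4.2.9] -/
theorem Current.IsRectifiable.exists_skeleton_retract_one (b : OrthonormalBasis (Fin n) ℝ V)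
    (hn : 1 ≤ n) :
    ∃ γ' : ℝ, 0 ≤ γ' ∧ ∀ {ε : ℝ}, 0 < ε →
      ∀ {S : Current (⊤ : Opens V) (0 + 1)}, S.IsRectifiable → S.boundary.mass ≠ ⊤ →
        ∃ (Q R : Current (⊤ : Opens V) (0 + 1)) (H : Current (⊤ : Opens V) (0 + 1 + 1)),
          Q.IsRectifiable ∧ Q.support ⊆ skeletonV b 1 ε ∧
          Q.boundary.mass ≤ S.boundary.mass ∧
          Q.support ⊆ cthickening (3 * Real.sqrt n * ε) S.support ∧
          R.support ⊆ cthickening (3 * Real.sqrt n * ε) S.support ∧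
          H.support ⊆ cthickening (3 * Real.sqrt n * ε) S.support ∧
          S - Q = R + H.boundary ∧
          R.mass ≤ ENNReal.ofReal (ε * γ') * S.boundary.mass := by
  classical
  set γ' : ℝ := 2 * (n : ℝ) ^ 2 + Real.sqrt n with hγ'def
  have hγ' : 0 ≤ γ' := by rw [hγ'def]; positivity
  refine ⟨γ', hγ', fun {ε} hε {S} hS hdS => ?_⟩
  /- Step 0: basics. -/
  have hn0 : 0 < n := hn
  have hSm : S.mass ≠ ⊤ := hS.mass_ne_top'
  have hsupp : IsCompact S.support := hS.2
  haveI : IsFiniteMeasure S.variation := ⟨lt_of_le_of_lt (S.variation_le_mass _) hSm.lt_top⟩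
  /- Step 1: a good translation for `‖S‖`. -/
  obtain ⟨a, ha, hreg, h1, -, h3, -⟩ := exists_good_translateV' b (ε := ε) S.variation S.variation
    1 1 (ν := fun _ : Fin 1 => S.variation)
  have hregS : S.variation {x | model b ε x + a ∉ regularSet n} = 0 := hreg 0
  /- Step 2: control function, maps, admissibility, weight. -/
  set v : V → ℝ := vσ b ε a 1 with hvdef
  have hv : LipschitzWith 1 v := lipschitzWith_vσ b hε 1
  have hvε : ∀ x, v x ≤ ε := vσ_le b hε.le 1
  set C : ℝ := 8 * n * Real.sqrt n * ε with hCdef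
  have hC : 0 ≤ C := by positivity
  set g : ℕ → V → V := fun j => gσ b ε a (1 + j) with hgdef
  have hadm : ∀ j, Admissible v (g j) C := fun j => admissible_gσ b hε hn0 (Nat.le_add_right _ _)
  set η₀ : ℝ := 2 * Real.sqrt n * ε with hη₀def
  have hη₀ : 0 ≤ η₀ := by positivity
  have hclose : ∀ j, ∀ x, 0 < v x → ‖g (j + 1) x - g j x‖ ≤ η₀ := fun j x _ => by
    simp only [hgdef, show 1 + (j + 1) = 1 + j + 1 by ring]
    exact norm_gσ_succ_sub_le b hε _ x
  have hIeq := lintegral_admWeight_vσ_eq b hε 0 S.variation h1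
  have hIle : ∫⁻ x, admWeight v 0 x ∂S.variation ≤
      ENNReal.ofReal (ε⁻¹ ^ (0 + 1)) * (ENNReal.ofReal (4 * avgConst n 1 / 2 ^ n) * S.mass) := by
    rw [hvdef, hIeq]
    exact mul_le_mul' le_rfl (h3.trans (mul_le_mul' le_rfl (S.variation_le_mass _)))
  have hI : ∫⁻ x, admWeight v 0 x ∂S.variation ≠ ⊤ :=
    ne_top_of_le_ne_top (ENNReal.mul_ne_top ENNReal.ofReal_ne_top
      (ENNReal.mul_ne_top ENNReal.ofReal_ne_top hSm)) hIle
  /- Step 3: a good sequence. -/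
  obtain ⟨RS⟩ := S.exists_goodSeq hSm hdS hv hε (P := fun _ => True) (Eventually.of_forall fun _ => trivial)
  /- Step 4: the currents. -/
  set N : ℕ := n - 1 with hN
  have hkN : 1 + N = n := by omega
  set B : ℕ → Current (⊤ : Opens V) (0 + 1) := fun j =>
    S.admPushLim b hSm hsupp hv.continuous (hadm j) hC hε RS hvε hI with hB
  set SH : ℕ → Current (⊤ : Opens V) (0 + 1 + 1) := fun j =>
    S.admHomLim b hSm hsupp hv.continuous (hadm j) (hadm (j + 1)) hC hη₀ (hclose j) hε RS hvε hI with hSH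
  set E : ℕ → Current (⊤ : Opens V) (0 + 1) := fun j => B (j + 1) - B j - (SH j).boundary with hE
  have hEmass : ∀ j, (E j).mass ≤ ENNReal.ofReal (Real.sqrt n * η₀) * S.boundary.mass := fun j =>
    S.mass_admHomError_le_one b hSm hdS hsupp hv (hadm j) (hadm (j + 1)) hC hη₀ (hclose j) hε hvε hI RS RS RS
  have hstep : ∀ j, B (j + 1) - B j = E j + (SH j).boundary := fun j => by
    simp only [hE]; abel
  have htel : B N - B 0 = ∑ j ∈ Finset.range N, E j + (∑ j ∈ Finset.range N, SH j).boundary := by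
    rw [Current.boundary_finset_sum, ← Finset.sum_add_distrib, ← Finset.sum_range_sub]
    exact Finset.sum_congr rfl fun j _ => hstep j
  -- the last map is the translation
  have hgN : g N = fun x => x + transV b ε a := by
    funext x; simp only [hgdef, hkN]; exact gσ_of_le b hε.ne' le_rfl x
  have hgNlip : LipschitzWith 1 (g N) := by
    rw [hgN]; exact LipschitzWith.of_dist_le_mul fun x y => by simp
  have hgNs : ContDiff ℝ ∞ (g N) := by rw [hgN]; exact contDiff_id.add contDiff_const
  have hBN : B N = S.lipPushforward hSm hdS hsupp hgNlip ⊤ :=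
    S.admPushLim_eq_lipPushforward b hSm hdS hsupp hv (hadm N) hC hgNlip hε RS hvε hI
  -- the affine homotopy from the translation to the identity (degree-zero error `EL`)
  obtain ⟨hUo, hTU, hχ1, hχabs⟩ := S.cutoff_spec hsupp
  obtain ⟨hVo, h01, hρ1, hρabs, hρ2⟩ := timeCutoff_spec
  set SL : Current (⊤ : Opens V) (0 + 1 + 1) :=
    (S.prodInterval 0 1).pushforward ⊤ (TestFunction.tensorCutoff timeCutoff (S.cutoff hsupp))
      (contDiff_affineHomotopy hgNs contDiff_id) with hSL
  set EL : Current (⊤ : Opens V) (0 + 1) :=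
    (S.boundary.prodInterval 0 1).pushforward ⊤ (TestFunction.tensorCutoff timeCutoff (S.cutoff hsupp))
      (contDiff_affineHomotopy hgNs contDiff_id) with hEL
  have hlast : S - B N = SL.boundary + EL := by
    have h := S.homotopy_formula_affine (Ω' := (⊤ : Opens V)) (S.cutoff hsupp) timeCutoff hgNs
      contDiff_id hUo hTU hχ1 hVo h01 hρ1
    rw [S.pushforward_id (S.cutoff hsupp) hUo hTU hχ1,
      ← S.lipPushforward_eq_pushforward hSm hdS hsupp hgNlip hgNs, ← hBN] at h
    exact h
  /- Step 5: localisation data. -/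
  set O : Set V := {x | model b ε (x + transV b ε a) ∈ regularSet n} with hOdef
  have hO : IsOpen O := isOpen_regularV b
  have hnull : S.variation Oᶜ = 0 := by
    have : Oᶜ = {x | model b ε x + a ∉ regularSet n} := by
      ext x; simp [hOdef, model_add_transV b hε.ne']
    rw [this]; exact hregS
  have hgO : ∀ j, ∀ x ∈ O, ContDiffAt ℝ ∞ (g j) x := fun j x hx => contDiffAt_gσ b _ hx
  obtain ⟨ρ, hρ0, hρ⟩ := hsupp.isBounded.subset_closedBall_lt 0 0
  set δ : ℝ := Real.sqrt n * ε with hδ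
  have hδpos : 0 < δ := by rw [hδ]; exact mul_pos (Real.sqrt_pos.2 (by exact_mod_cast hn0)) hε
  have hδ0 : 0 ≤ δ := hδpos.le
  set Bs : Set V := thickening δ S.support with hBsdef
  have hBs : IsOpen Bs := isOpen_thickening
  have hSBs : S.support ⊆ Bs := self_subset_thickening hδpos _
  set K : Set V := closedBall (0 : V) (ρ + 3 * δ) with hKdef
  have hK : IsCompact K := isCompact_closedBall _ _
  set Z : Set V := cthickening (3 * Real.sqrt n * ε) S.support with hZdef
  have hZc : IsClosed Z := isClosed_cthickening
  have hgdist : ∀ j x, dist (g j x) x ≤ 2 * δ := fun j x => by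
    rw [hδ]; have := dist_gσ_self_le b hε ha (1 + j) x; linarith
  have hsegdist : ∀ j, ∀ t ∈ Set.Icc (0 : ℝ) 1, ∀ x,
      dist (g j x + t • (g (j + 1) x - g j x)) x ≤ 2 * δ := by
    intro j t ht x
    have e : g j x + t • (g (j + 1) x - g j x) - x = (1 - t) • (g j x - x) + t • (g (j + 1) x - x) := by
      simp only [smul_sub, sub_smul, one_smul]; abel
    rw [dist_eq_norm, e]
    calc ‖(1 - t) • (g j x - x) + t • (g (j + 1) x - x)‖
        ≤ ‖(1 - t) • (g j x - x)‖ + ‖t • (g (j + 1) x - x)‖ := norm_add_le _ _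
      _ ≤ (1 - t) * (2 * δ) + t * (2 * δ) := by
          rw [norm_smul, norm_smul, Real.norm_eq_abs, Real.norm_eq_abs,
            abs_of_nonneg (by linarith [ht.2]), abs_of_nonneg ht.1, ← dist_eq_norm, ← dist_eq_norm]
          exact add_le_add (mul_le_mul_of_nonneg_left (hgdist j x) (by linarith [ht.2]))
            (mul_le_mul_of_nonneg_left (hgdist (j + 1) x) ht.1)
      _ = 2 * δ := by ring
  have hBZ : ∀ {x y : V}, x ∈ Bs → dist y x ≤ 2 * δ → y ∈ Z := by
    intro x y hx hyx
    obtain ⟨z, hz, hxz⟩ := mem_thickening_iff.1 hx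
    refine mem_cthickening_of_dist_le y z _ _ hz ?_
    calc dist y z ≤ dist y x + dist x z := dist_triangle _ _ _
      _ ≤ 2 * δ + δ := add_le_add hyx hxz.le
      _ = 3 * Real.sqrt n * ε := by rw [hδ]; ring
  have hBK : ∀ {x y : V}, x ∈ Bs → dist y x ≤ 2 * δ → y ∈ K := by
    intro x y hx hyx
    obtain ⟨z, hz, hxz⟩ := mem_thickening_iff.1 hx
    rw [hKdef, mem_closedBall, dist_zero_right]
    have hz' : ‖z‖ ≤ ρ := mem_closedBall_zero_iff.1 (hρ hz)
    calc ‖y‖ = dist y 0 := (dist_zero_right _).symm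
      _ ≤ dist y x + (dist x z + dist z 0) :=
          (dist_triangle _ _ _).trans (add_le_add le_rfl (dist_triangle _ _ _))
      _ ≤ 2 * δ + (δ + ρ) := add_le_add hyx (add_le_add hxz.le (by rwa [dist_zero_right]))
      _ = ρ + 3 * δ := by ring
  have hgZ : ∀ j, Set.MapsTo (g j) ({x | 0 < v x} ∩ Bs) Z := fun j x hx => hBZ hx.2 (hgdist j x)
  have hgK : ∀ j, Set.MapsTo (g j) ({x | 0 < v x} ∩ Bs) K := fun j x hx => hBK hx.2 (hgdist j x)
  have hsegZ : ∀ j, ∀ t ∈ Set.Icc (0 : ℝ) 1, ∀ x ∈ {x | 0 < v x} ∩ Bs,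
      g j x + t • (g (j + 1) x - g j x) ∈ Z := fun j t ht x hx => hBZ hx.2 (hsegdist j t ht x)
  /- Step 6: rectifiability and supports. -/
  have hQr : (B 0).IsRectifiable :=
    hS.admPushLim b hSm hsupp hv.continuous (hadm 0) hC hε RS hvε hI hO (hgO 0) hnull hBs hSBs hK (hgK 0)
  have hQskel : (B 0).support ⊆ skeletonV b 1 ε := by
    refine S.support_admPushLim_subset b hSm hsupp hv.continuous (hadm 0) hC hε RS hvε hI
      (isClosed_skeletonV b) fun x hx => ?_
    simp only [hgdef, add_zero]
    exact gσ_mem_skeletonV b hε le_rfl hx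
  have hBZ' : ∀ j, (B j).support ⊆ Z := fun j => by
    show ((S.admFamily b hSm hsupp hv.continuous (hadm j) hC).lim hε RS hvε hI).support ⊆ Z
    exact (S.admFamily b hSm hsupp hv.continuous (hadm j) hC).support_lim_subset hε RS hI hvε hZc
      fun i => S.support_admPush_subset' b hSm hsupp hv.continuous (hadm j) hC (RS.pos hε i) (RS.good i)
        hBs hSBs hZc (hgZ j)
  have hSHZ : ∀ j, (SH j).support ⊆ Z := fun j =>
    S.support_admHomLim_subset b hSm hsupp hv.continuous (hadm j) (hadm (j + 1)) hC hη₀ (hclose j) hε RS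
      hvε hI hBs hSBs hZc (hsegZ j)
  have haV : ‖transV b ε a‖ ≤ δ := norm_transV_le b hε.le ha
  have haffZ : ∀ p ∈ Set.Icc (0 : ℝ) 1 ×ˢ S.support,
      affineHomotopy (g N) id p ∈ Z := fun p hp => by
    refine hBZ (hSBs hp.2) ?_
    simp only [affineHomotopy, hgN, id_eq]
    rw [dist_eq_norm, show p.2 + transV b ε a + p.1 • (p.2 - (p.2 + transV b ε a)) - p.2 =
      (1 - p.1) • transV b ε a by simp only [smul_sub, sub_smul, one_smul, smul_add]; abel]
    rw [norm_smul, Real.norm_eq_abs, abs_of_nonneg (by linarith [hp.1.2])]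
    calc (1 - p.1) * ‖transV b ε a‖ ≤ 1 * δ :=
        mul_le_mul (by linarith [hp.1.1]) haV (norm_nonneg _) zero_le_one
      _ ≤ 2 * δ := by linarith
  have hSLZ : SL.support ⊆ Z := by
    refine ((S.prodInterval 0 1).support_pushforward_subset _ _).trans (closure_minimal ?_ hZc)
    rintro _ ⟨p, ⟨-, hp⟩, rfl⟩
    have hp' := S.support_prodInterval_subset 0 1 hp
    rw [Set.uIcc_of_le zero_le_one] at hp'
    exact haffZ p hp'
  have hELZ : EL.support ⊆ Z := by
    refine ((S.boundary.prodInterval 0 1).support_pushforward_subset _ _).trans (closure_minimal ?_ hZc)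
    rintro _ ⟨p, ⟨-, hp⟩, rfl⟩
    have hp' := S.boundary.support_prodInterval_subset 0 1 hp
    rw [Set.uIcc_of_le zero_le_one] at hp'
    exact haffZ p ⟨hp'.1, S.support_boundary_subset hp'.2⟩
  have hEZ : ∀ j, (E j).support ⊆ Z := fun j => by
    simp only [hE, sub_eq_add_neg]
    refine (Current.support_add_subset _ _).trans (union_subset ((Current.support_add_subset _ _).trans
      (union_subset (hBZ' (j + 1)) ?_)) ?_)
    · rw [Current.support_neg]; exact hBZ' j
    · rw [Current.support_neg]; exact ((SH j).support_boundary_subset).trans (hSHZ j)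
  /- Step 7: masses. -/
  have hmassEL : EL.mass ≤ ENNReal.ofReal (Real.sqrt n * ε) * S.boundary.mass := by
    refine S.boundary.mass_affineHomotopy_le _ _ hgNs contDiff_id (by positivity) hρabs
      fun t _ x _ => ?_
    rw [pow_zero, mul_one]
    have h2 : ‖id x - g N x‖ ≤ δ := by
      rw [hgN]; simp only [id_eq, sub_add_cancel_left, norm_neg]; exact haV
    calc |S.cutoff hsupp x| * ‖id x - g N x‖ ≤ 1 * δ :=
        mul_le_mul (hχabs x) h2 (norm_nonneg _) zero_le_one
      _ = Real.sqrt n * ε := by rw [hδ]; ring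
  have hsqrt : Real.sqrt n * Real.sqrt n = n := Real.mul_self_sqrt (Nat.cast_nonneg n)
  have hmassE : ∀ j, (E j).mass ≤ ENNReal.ofReal (ε * (2 * n)) * S.boundary.mass := fun j => by
    refine (hEmass j).trans (le_of_eq ?_)
    congr 2
    rw [hη₀def]
    calc Real.sqrt n * (2 * Real.sqrt n * ε) = 2 * (Real.sqrt n * Real.sqrt n) * ε := by ring
      _ = ε * (2 * n) := by rw [hsqrt]; ring
  /- Step 8: conclusion. -/
  refine ⟨B 0, EL + ∑ j ∈ Finset.range N, E j, SL + ∑ j ∈ Finset.range N, SH j, hQr, hQskel,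
    ?_, hBZ' 0, ?_, ?_, ?_, ?_⟩
  · exact S.mass_boundary_admPushLim_le_one b hSm hdS hsupp hv (hadm 0) hC hε hvε hI RS
  · exact (Current.support_add_subset _ _).trans
      (Set.union_subset hELZ (Current.support_finset_sum_subset E hEZ N))
  · exact (Current.support_add_subset _ _).trans
      (Set.union_subset hSLZ (Current.support_finset_sum_subset SH hSHZ N))
  · -- `S − Q = R + ∂H`
    have e1 : S - B 0 = (S - B N) + (B N - B 0) := by abel
    rw [e1, hlast, htel, Current.boundary_add]
    abel
  · -- mass of `R`
    have hN' : (N : ℝ) ≤ n := by exact_mod_cast Nat.sub_le n 1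
    calc (EL + ∑ j ∈ Finset.range N, E j).mass
        ≤ EL.mass + (∑ j ∈ Finset.range N, E j).mass := Current.mass_add_le _ _
      _ ≤ ENNReal.ofReal (Real.sqrt n * ε) * S.boundary.mass +
          ∑ j ∈ Finset.range N, ENNReal.ofReal (ε * (2 * n)) * S.boundary.mass :=
          add_le_add hmassEL ((Current.mass_finset_sum_le E N).trans
            (Finset.sum_le_sum fun j _ => hmassE j))
      _ = (ENNReal.ofReal (Real.sqrt n * ε) +
            (N : ℝ≥0∞) * ENNReal.ofReal (ε * (2 * n))) * S.boundary.mass := by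
          rw [Finset.sum_const, Finset.card_range, nsmul_eq_mul, add_mul, mul_assoc]
      _ ≤ ENNReal.ofReal (ε * γ') * S.boundary.mass := by
          refine mul_le_mul' ?_ le_rfl
          rw [show (N : ℝ≥0∞) = ENNReal.ofReal (N : ℝ) by rw [ENNReal.ofReal_natCast],
            ← ENNReal.ofReal_mul (Nat.cast_nonneg N),
            ← ENNReal.ofReal_add (by positivity) (by positivity)]
          refine ENNReal.ofReal_le_ofReal ?_
          rw [hγ'def]
          nlinarith [mul_nonneg hε.le (Nat.cast_nonneg N), Real.sqrt_nonneg n,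
            mul_nonneg hε.le (by positivity : (0 : ℝ) ≤ 2 * n)]

end Retract

end Literature.Geometry.GeometricMeasureTheory
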